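import Literature.MathematicalPhysics.QuantumFieldTheory.Balaban1983to89.B9Ineq349L2HomReadings

/-!
# `Balaban1983to89.B9Ineq349L2ReadingsP` — B9 p. 399 (3.49) IN BLOCK-`ℓ²` FROM READINGS, WITH THE `C⁻¹` CARRIER GENERIC (a block carrier `Y` with a block map
# `blkY`, e.g. NODE 00's `BlkY × ι`): the sandwich `Q′*∘C⁻¹∘Q′`, the four one-carrier entries, and the three two-carrier entries the (3.77)-brick consumes
# (pub-ymgap N06 row 13, G side, `L²` member: brick F2a of the `Read377L2` port)

T. Bałaban, *Propagators for lattice gauge theories in a background field*, Commun. Math. Phys. **99** (1985) 389–434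
[`Balaban1985BackgroundPropagators`, "B9"], (3.25) p. 394, Thm 3.2 (3.48) p. 398, (3.49) p. 399; [4] = T. Bałaban, *Propagators and renormalization
transformations for lattice gauge theories. II*, Commun. Math. Phys. **96** (1984) 223–250 [`Balaban1984PropagatorsII`], (2.52)–(2.55) p. 232, Lemma 2.1
p. 234, Prop. 2.6 (2.140)–(2.141) p. 247.

statement-level skeleton of published theorems with citation tags; proofs where landed; nothing here is a claim about the Yang–Mills mass gap

WHY THIS FILE (seat dag-n06-c gen 14, READ377L2-PORT-PLAN F2a).  r06's `B6RandomWalkL2Hom.hasL2Majorant_sandwich`, g5's `B9Ineq349L2Readings` and g6's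
`B9Ineq349L2HomReadings` fix the carrier of `C⁻¹ = (Q′G′²Q′*)⁻¹` to the lattice of blocks itself (`g.Site`, block map `id`, entry bound `|C⁻¹(δ_{y′})(y)|`) —
the scalar model.  In NODE 00's coded frames the C side is matrix valued: `C⁻¹(V)` acts on `BlkY × ι` (`B9SectBKerLettersY.CopC`) and its (3.48) datum is a
block-`ℓ²` majorant there.  The proofs are carrier-agnostic; this file restates the three results with a generic middle carrier `Y`, block map `blkY`, and
the (3.48) datum as a block-`ℓ²` majorant `C⁻¹ ≺₂ B_C·(Lʲη)⁻⁴·e^{−δ_C d}` on `Y`: §1 `hasL2Majorant_sandwichP`; §2 `hasL2Majorant_QcsCQc_of_readingsP`,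
`ineq349_l2_of_readingsP`; §3 ★★ `ineq349_l2Hom_of_readingsP` (the hypotheses `hP`, `hDP`, `hPDs` of `B9Ineq377L2Hom.ineq377_l2_concreteE`).

HONEST SCOPE.  Finite-dimensional bookkeeping; every letter a binder with its reading as hypothesis; nothing of [B9] asserted for Bałaban's operators;
count-neutral; NOT a node discharge; nothing continuum ∕ OS ∕ mass-gap ∕ Clay.  Cell `pub-ymgap` (HUMAN RULING D-0062), Track A node N06 [B9], row 13, 2026-08-29.
-/

noncomputable section

open scoped BigOperators

namespace Literature.MathematicalPhysics.QuantumFieldTheory.Balaban1983to89.B9Ineq349L2ReadingsP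

open B6RandomWalk (Triangle254 Ineq261)
open B6RandomWalkL2 (HasL2Majorant hasL2Majorant_mono hasL2Majorant_zero)
open B6RandomWalkL2Hom (HasL2MajorantHom hasL2MajorantHom_mono hasL2MajorantHom_comp hasL2MajorantHom_iff)
open B9Thm34Ext (toB6)
open B9Ineq347 (ScaleTransfer)
open B9Ineq363L2 (hasL2Majorant_rate_mono)
open B9Ineq366L2 (ineq349_l2_sandwich)
open B9Eq352DivFormLetters (conj)
open B9Eq352GradLetters (diffLetter)
open B9Eq376POneLetters (conjHom gradLin divLin)
open B9Eq376L2DerivDict (hasL2MajorantHom_gradLin_comp hasL2MajorantHom_comp_divLin)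

/-! ## §1 The sandwich through a generic middle carrier -/

section Sandwich

variable {G₆ : B6.Geometry} [DecidableEq G₆.Site] {X Y : Type} [Fintype X] [Fintype Y]

/-- ★ **THE SANDWICH `Q′*∘L∘Q′` IN BLOCK-ℓ², MIDDLE CARRIER GENERIC** — r06's `B6RandomWalkL2Hom.hasL2Majorant_sandwich` with the lattice of blocks replaced by
any carrier `Y` with block map `blkY` (same proof). [cite: Balaban1984PropagatorsII, (2.52)–(2.55) p.232, (2.140)–(2.141) p.247; Balaban1985BackgroundPropagators, (3.25) p.394, (3.48) p.398, p.398 (remark after (3.47))] -/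
theorem hasL2Majorant_sandwichP (blkX : X → G₆.Site) (blkY : Y → G₆.Site) (δ α Λ κc κs B : ℝ) (wc ws v : G₆.Site → ℝ)
    (hκc : 0 ≤ κc) (hκs : 0 ≤ κs) (hB : 0 ≤ B) (hΛ : 0 ≤ Λ) (hws : ∀ a, 0 ≤ ws a) (hv : ∀ a, 0 ≤ v a)
    (hprod : ∀ a, ws a * wc a ≤ 1) (hT : ∀ a b : G₆.Site, Real.exp (-(α * δ * G₆.dist a b)) * wc b ≤ Λ * wc a)
    {Qc : (X → ℝ) →ₗ[ℝ] (Y → ℝ)} {L : Module.End ℝ (Y → ℝ)} {Qcs : (Y → ℝ) →ₗ[ℝ] (X → ℝ)}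
    (hQc : HasL2MajorantHom blkX blkY Qc (fun a b => if a = b then κc * wc a else 0))
    (hL : HasL2Majorant blkY L (fun a b => B * v a * Real.exp (-(δ * G₆.dist a b))))
    (hQcs : HasL2MajorantHom blkY blkX Qcs (fun a b => if a = b then κs * ws a else 0)) :
    HasL2Majorant blkX (Qcs ∘ₗ L ∘ₗ Qc) (fun a b => (κs * κc * B * Λ) * v a * Real.exp (-((1 - α) * δ * G₆.dist a b))) := by
  -- L ∘ Q′ : X → Y
  have hLQ : HasL2MajorantHom blkX blkY (L ∘ₗ Qc) (fun a b => B * v a * Real.exp (-(δ * G₆.dist a b)) * (κc * wc b)) := by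
    have h := hasL2MajorantHom_comp blkX blkY blkY (S := (L : (Y → ℝ) →ₗ[ℝ] (Y → ℝ))) hQc ((hasL2MajorantHom_iff _ _ _).mpr hL)
      (fun a b => by have := hv a; positivity)
    refine hasL2MajorantHom_mono _ _ h fun a b => le_of_eq ?_
    rw [Finset.sum_eq_single b]
    · simp
    · intro y'' _ hne; simp [hne]
    · intro hb; exact absurd (Finset.mem_univ b) hb
  have hK : ∀ a b : G₆.Site, 0 ≤ (if a = b then κs * ws a else 0) := fun a b => by
    split_ifs
    · exact mul_nonneg hκs (hws a)
    · exact le_rfl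
  have h3 := hasL2MajorantHom_comp blkX blkY blkX hLQ hQcs hK
  have h3' : HasL2Majorant blkX (Qcs ∘ₗ L ∘ₗ Qc) (fun a b => (κs * ws a) * (B * v a * Real.exp (-(δ * G₆.dist a b)) * (κc * wc b))) := by
    refine (hasL2MajorantHom_iff _ _ _).mp (hasL2MajorantHom_mono _ _ h3 fun a b => le_of_eq ?_)
    rw [Finset.sum_eq_single a]
    · simp
    · intro y'' _ hne; simp [Ne.symm hne]
    · intro ha; exact absurd (Finset.mem_univ a) ha
  refine hasL2Majorant_mono blkX h3' fun a b => ?_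
  have hsplit : Real.exp (-(δ * G₆.dist a b)) = Real.exp (-((1 - α) * δ * G₆.dist a b)) * Real.exp (-(α * δ * G₆.dist a b)) := by
    rw [← Real.exp_add]; congr 1; ring
  have htr := hT a b
  calc κs * ws a * (B * v a * Real.exp (-(δ * G₆.dist a b)) * (κc * wc b))
      = (κs * κc * B * v a * Real.exp (-((1 - α) * δ * G₆.dist a b))) * (ws a * (Real.exp (-(α * δ * G₆.dist a b)) * wc b)) := by
        rw [hsplit]; ring
    _ ≤ (κs * κc * B * v a * Real.exp (-((1 - α) * δ * G₆.dist a b))) * (ws a * (Λ * wc a)) := by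
        refine mul_le_mul_of_nonneg_left (mul_le_mul_of_nonneg_left htr (hws a)) ?_
        have := hv a; positivity
    _ = (κs * κc * B * Λ) * v a * Real.exp (-((1 - α) * δ * G₆.dist a b)) * (ws a * wc a) := by ring
    _ ≤ (κs * κc * B * Λ) * v a * Real.exp (-((1 - α) * δ * G₆.dist a b)) * 1 := by
        refine mul_le_mul_of_nonneg_left (hprod a) ?_
        have := hv a; positivity
    _ = (κs * κc * B * Λ) * v a * Real.exp (-((1 - α) * δ * G₆.dist a b)) := by ring

end Sandwich

/-! ## §2 `M = Q′*∘C⁻¹∘Q′` and the four one-carrier (3.49) entries from readings, middle carrier generic -/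

section Readings

variable {𝔸 : Type*} [NormedRing 𝔸] [NormedAlgebra ℂ 𝔸] {ι : Type} [Fintype ι]
variable {g : B9.Geometry} [Fintype g.Site] [DecidableEq g.Site] {R : ℝ} {H : Prop} {W Y : Type} [Fintype W] [Fintype Y]

/-- ★ **`Q′*∘C⁻¹∘Q′ ≺₂ κ_sκ_cB_CΛ_C·(Lʲη)⁻⁴·e^{−δd}` FROM THE READINGS, MIDDLE CARRIER GENERIC**: as `B9Ineq349L2Readings.hasL2Majorant_QcsCQc_of_readings`, the
(3.48) datum now a block-`ℓ²` majorant of `C⁻¹` on `Y` at the rate `δ_C`. [cite: Balaban1985BackgroundPropagators, (3.25) p.394, (3.48) p.398, p.398 (remark after (3.47)); Balaban1984PropagatorsII, (2.52)–(2.55) p.232, (2.140)–(2.141) p.247] -/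
theorem hasL2Majorant_QcsCQc_of_readingsP (blk : W → g.Site) (blkY : Y → g.Site) (δ δC αC ΛC κc κs BC : ℝ) (wc ws : g.Site → ℝ)
    (hκc : 0 ≤ κc) (hκs : 0 ≤ κs) (hBC : 0 ≤ BC) (hΛC : 0 ≤ ΛC) (hws : ∀ a, 0 ≤ ws a) (hprod : ∀ a, ws a * wc a ≤ 1)
    (hδ : δ ≤ (1 - αC) * δC) (hdnn : ∀ a b : g.Site, 0 ≤ g.dist a b)
    (hTC : ∀ a b : g.Site, Real.exp (-(αC * δC * g.dist a b)) * wc b ≤ ΛC * wc a)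
    {Qc : (W → ℝ) →ₗ[ℝ] (Y → ℝ)} {Cop : Module.End ℝ (Y → ℝ)} {Qcs : (Y → ℝ) →ₗ[ℝ] (W → ℝ)}
    (hQc : HasL2MajorantHom (g := toB6 g R H) blk blkY Qc (fun a b : g.Site => if a = b then κc * wc a else 0))
    (hQcs : HasL2MajorantHom (g := toB6 g R H) blkY blk Qcs (fun a b : g.Site => if a = b then κs * ws a else 0))
    (h348 : HasL2Majorant (g := toB6 g R H) blkY Cop (fun a b => BC * (g.len a ^ 4)⁻¹ * Real.exp (-(δC * g.dist a b)))) :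
    HasL2Majorant (g := toB6 g R H) blk (Qcs ∘ₗ Cop ∘ₗ Qc)
      (fun a b => κs * κc * BC * ΛC * (g.len a ^ 4)⁻¹ * Real.exp (-(δ * g.dist a b))) := by
  letI : DecidableEq (toB6 g R H).Site := ‹DecidableEq g.Site›
  have hv : ∀ a : g.Site, 0 ≤ (g.len a ^ 4)⁻¹ := fun a => inv_nonneg.mpr (by positivity)
  have hS := hasL2Majorant_sandwichP (G₆ := toB6 g R H) blk blkY δC αC ΛC κc κs BC wc ws (fun a => (g.len a ^ 4)⁻¹) hκc hκs hBC hΛC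
    hws hv hprod hTC hQc h348 hQcs
  have hA : 0 ≤ κs * κc * BC * ΛC := by positivity
  exact hasL2Majorant_rate_mono (R := R) (H := H) blk (κs * κc * BC * ΛC) (fun a => (g.len a ^ 4)⁻¹) hA hv hδ hdnn hS

/-- ★★ **THE FOUR (3.49) ENTRIES FROM THE READINGS, MIDDLE CARRIER GENERIC** — `B9Ineq349L2Readings.ineq349_l2_of_readings` with `C⁻¹` on `Y` and its (3.48)
datum a block-`ℓ²` majorant. [cite: Balaban1985BackgroundPropagators, (3.25) p.394, (3.48)–(3.49) pp.398–399, (3.42) p.397; Balaban1984PropagatorsII, Lemma 2.1 p.234, (2.52)–(2.55) p.232, (2.140)–(2.141) p.247] -/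
theorem ineq349_l2_of_readingsP (blk : W → g.Site) (blkY : Y → g.Site) (d : ℕ) (δ₀ δ α β ρ Λ B₀ δC αC ΛC κc κs BC : ℝ) (wc ws : g.Site → ℝ)
    (hB₀ : 0 ≤ B₀) (hΛ : 1 ≤ Λ) (hρ : 0 ≤ ρ) (hα : 0 ≤ α) (hβ : 0 ≤ β) (hδ₀ : 0 ≤ δ₀) (hr : ρ + (2 * α + β) * δ₀ ≤ δ)
    (hκc : 0 ≤ κc) (hκs : 0 ≤ κs) (hBC : 0 ≤ BC) (hΛC : 0 ≤ ΛC) (hws : ∀ a, 0 ≤ ws a) (hprod : ∀ a, ws a * wc a ≤ 1)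
    (hδC : δ ≤ (1 - αC) * δC)
    (hdnn : ∀ a b : g.Site, 0 ≤ g.dist a b) (htri : Triangle254 (toB6 g R H)) (hlen : ∀ y : g.Site, 0 < g.len y)
    (h261 : Ineq261 d (toB6 g R H) δ₀ β)
    (hT1 : ScaleTransfer g δ₀ α Λ (fun a => g.len a)) (hT2 : ScaleTransfer g δ₀ α Λ (fun a => g.len a ^ 2))
    (hT4 : ScaleTransfer g δ₀ α Λ (fun a => (g.len a ^ 4)⁻¹))
    (hTC : ∀ a b : g.Site, Real.exp (-(αC * δC * g.dist a b)) * wc b ≤ ΛC * wc a)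
    {G D Ds : Module.End ℝ (W → ℝ)}
    {Qc : (W → ℝ) →ₗ[ℝ] (Y → ℝ)} {Cop : Module.End ℝ (Y → ℝ)} {Qcs : (Y → ℝ) →ₗ[ℝ] (W → ℝ)}
    (hG : HasL2Majorant (g := toB6 g R H) blk G (fun a b => B₀ * g.len a ^ 2 * Real.exp (-(δ * g.dist a b))))
    (hDG : HasL2Majorant (g := toB6 g R H) blk (D * G) (fun a b => B₀ * g.len a * Real.exp (-(δ * g.dist a b))))
    (hGDs : HasL2Majorant (g := toB6 g R H) blk (G * Ds) (fun a b => B₀ * g.len a * Real.exp (-(δ * g.dist a b))))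
    (hQc : HasL2MajorantHom (g := toB6 g R H) blk blkY Qc (fun a b : g.Site => if a = b then κc * wc a else 0))
    (hQcs : HasL2MajorantHom (g := toB6 g R H) blkY blk Qcs (fun a b : g.Site => if a = b then κs * ws a else 0))
    (h348 : HasL2Majorant (g := toB6 g R H) blkY Cop (fun a b => BC * (g.len a ^ 4)⁻¹ * Real.exp (-(δC * g.dist a b)))) :
    HasL2Majorant (g := toB6 g R H) blk (G * (Qcs ∘ₗ Cop ∘ₗ Qc) * G)
        (fun a b => B9Ineq368PPrime.kappa349 1 B₀ (κs * κc * BC * ΛC) Λ (B6.c1 d δ₀ β) * Real.exp (-(ρ * g.dist a b))) ∧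
      HasL2Majorant (g := toB6 g R H) blk (D * (G * (Qcs ∘ₗ Cop ∘ₗ Qc) * G))
        (fun a b => B9Ineq368PPrime.kappa349 1 B₀ (κs * κc * BC * ΛC) Λ (B6.c1 d δ₀ β) * (g.len a)⁻¹ * Real.exp (-(ρ * g.dist a b))) ∧
      HasL2Majorant (g := toB6 g R H) blk (G * (Qcs ∘ₗ Cop ∘ₗ Qc) * G * Ds)
        (fun a b => B9Ineq368PPrime.kappa349 1 B₀ (κs * κc * BC * ΛC) Λ (B6.c1 d δ₀ β) * (g.len a)⁻¹ * Real.exp (-(ρ * g.dist a b))) ∧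
      HasL2Majorant (g := toB6 g R H) blk (D * (G * (Qcs ∘ₗ Cop ∘ₗ Qc) * G) * Ds)
        (fun a b => B9Ineq368PPrime.kappa349 1 B₀ (κs * κc * BC * ΛC) Λ (B6.c1 d δ₀ β) * (g.len a ^ 2)⁻¹ *
          Real.exp (-(ρ * g.dist a b))) := by
  have hM := hasL2Majorant_QcsCQc_of_readingsP (R := R) (H := H) blk blkY δ δC αC ΛC κc κs BC wc ws hκc hκs hBC hΛC hws hprod hδC hdnn
    hTC hQc hQcs h348
  have hBM : 0 ≤ κs * κc * BC * ΛC := by positivity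
  exact ineq349_l2_sandwich (R := R) (H := H) blk d δ₀ δ α β ρ Λ B₀ (κs * κc * BC * ΛC) hB₀ hBM hΛ hρ hα hβ hδ₀ hr hdnn htri hlen
    h261 hT1 hT2 hT4 hG hDG hGDs hM

end Readings

/-! ## §3 ★★ The three (3.49) entries in the shapes of the (3.77)-brick, middle carrier generic -/

section Hom

variable {𝔸 : Type*} [NormedRing 𝔸] [NormedAlgebra ℂ 𝔸] {ι : Type} [Fintype ι]
variable (b : Module.Basis ι ℝ 𝔸) {S : Type} [Fintype S] {κ : Type} [Fintype κ]
variable (T : κ → Equiv.Perm S) (U : κ → S → 𝔸ˣ)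
variable {g : B9.Geometry} [Fintype g.Site] [DecidableEq g.Site] {R : ℝ} {H : Prop} {Y : Type} [Fintype Y]

/-- ★★ **THE THREE (3.49) ENTRIES OF `P = G′∘Q′*∘C⁻¹∘Q′∘G′` IN THE SHAPES `hP`, `hDP`, `hPDs` OF `B9Ineq377L2Hom.ineq377_l2_concreteE`, MIDDLE CARRIER GENERIC**
— g6's `B9Ineq349L2HomReadings.ineq349_l2Hom_of_readings` with `C⁻¹` on `Y` (block map `blkY`) and its (3.48) datum a block-`ℓ²` majorant (same proof).
[cite: Balaban1985BackgroundPropagators, (3.25) p.394, (3.48)–(3.49) pp.398–399, (3.76)–(3.77) pp.405–406, (3.8) p.392; Balaban1984PropagatorsII, Lemma 2.1 p.234, (2.52)–(2.55) p.232, Prop. 2.6 (2.140)–(2.141) p.247] -/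
theorem ineq349_l2Hom_of_readingsP (blk : S → g.Site) (blkY : Y → g.Site) (d : ℕ) (c : ℂ) (δ₀ δ α β ρ Λ B₀ δC αC ΛC κc κs BC : ℝ)
    (wc ws : g.Site → ℝ)
    (hB₀ : 0 ≤ B₀) (hΛ : 1 ≤ Λ) (hρ : 0 ≤ ρ) (hα : 0 ≤ α) (hβ : 0 ≤ β) (hδ₀ : 0 ≤ δ₀) (hr : ρ + (2 * α + β) * δ₀ ≤ δ)
    (hκc : 0 ≤ κc) (hκs : 0 ≤ κs) (hBC : 0 ≤ BC) (hΛC : 0 ≤ ΛC) (hws : ∀ a, 0 ≤ ws a) (hprod : ∀ a, ws a * wc a ≤ 1)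
    (hδC : δ ≤ (1 - αC) * δC)
    (hdnn : ∀ a a' : g.Site, 0 ≤ g.dist a a') (htri : Triangle254 (toB6 g R H)) (hlen : ∀ y : g.Site, 0 < g.len y)
    (h261 : Ineq261 d (toB6 g R H) δ₀ β)
    (hT1 : ScaleTransfer g δ₀ α Λ (fun a => g.len a)) (hT2 : ScaleTransfer g δ₀ α Λ (fun a => g.len a ^ 2))
    (hT4 : ScaleTransfer g δ₀ α Λ (fun a => (g.len a ^ 4)⁻¹))
    (hTC : ∀ a a' : g.Site, Real.exp (-(αC * δC * g.dist a a')) * wc a' ≤ ΛC * wc a)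
    {G : Module.End ℝ (S × ι → ℝ)}
    {Qc : (S × ι → ℝ) →ₗ[ℝ] (Y → ℝ)} {Cop : Module.End ℝ (Y → ℝ)} {Qcs : (Y → ℝ) →ₗ[ℝ] (S × ι → ℝ)}
    (hG : HasL2Majorant (g := toB6 g R H) (fun p : S × ι => blk p.1) G (fun a a' => B₀ * g.len a ^ 2 * Real.exp (-(δ * g.dist a a'))))
    (hDG : ∀ μ : κ, HasL2Majorant (g := toB6 g R H) (fun p : S × ι => blk p.1) (conj b (diffLetter T U c (Sum.inl μ)) * G)
      (fun a a' => B₀ * g.len a * Real.exp (-(δ * g.dist a a'))))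
    (hGDs : ∀ ν : κ, HasL2Majorant (g := toB6 g R H) (fun p : S × ι => blk p.1) (G * conj b (diffLetter T U c (Sum.inr ν)))
      (fun a a' => B₀ * g.len a * Real.exp (-(δ * g.dist a a'))))
    (hQc : HasL2MajorantHom (g := toB6 g R H) (fun p : S × ι => blk p.1) blkY Qc (fun a a' : g.Site => if a = a' then κc * wc a else 0))
    (hQcs : HasL2MajorantHom (g := toB6 g R H) blkY (fun p : S × ι => blk p.1) Qcs (fun a a' : g.Site => if a = a' then κs * ws a else 0))
    (h348 : HasL2Majorant (g := toB6 g R H) blkY Cop (fun a a' => BC * (g.len a ^ 4)⁻¹ * Real.exp (-(δC * g.dist a a')))) :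
    HasL2Majorant (g := toB6 g R H) (fun p : S × ι => blk p.1) (G ∘ₗ Qcs ∘ₗ Cop ∘ₗ Qc ∘ₗ G)
        (fun a a' => (1 + Real.sqrt (Fintype.card κ)) * B9Ineq368PPrime.kappa349 1 B₀ (κs * κc * BC * ΛC) Λ (B6.c1 d δ₀ β) *
          Real.exp (-(ρ * g.dist a a'))) ∧
      HasL2MajorantHom (g := toB6 g R H) (fun p : S × ι => blk p.1) (fun q : (κ × S) × ι => blk q.1.2)
        (conjHom b (gradLin T c U) ∘ₗ (G ∘ₗ Qcs ∘ₗ Cop ∘ₗ Qc ∘ₗ G))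
        (fun a a' => (1 + Real.sqrt (Fintype.card κ)) * B9Ineq368PPrime.kappa349 1 B₀ (κs * κc * BC * ΛC) Λ (B6.c1 d δ₀ β) *
          (g.len a)⁻¹ * Real.exp (-(ρ * g.dist a a'))) ∧
      HasL2MajorantHom (g := toB6 g R H) (fun q : (κ × S) × ι => blk q.1.2) (fun p : S × ι => blk p.1)
        ((G ∘ₗ Qcs ∘ₗ Cop ∘ₗ Qc ∘ₗ G) ∘ₗ conjHom b (divLin T c U))
        (fun a a' => (1 + Real.sqrt (Fintype.card κ)) * B9Ineq368PPrime.kappa349 1 B₀ (κs * κc * BC * ΛC) Λ (B6.c1 d δ₀ β) *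
          (g.len a)⁻¹ * Real.exp (-(ρ * g.dist a a'))) := by
  set κ₀ : ℝ := B9Ineq368PPrime.kappa349 1 B₀ (κs * κc * BC * ΛC) Λ (B6.c1 d δ₀ β) with hκ₀
  have hκ₀0 : 0 ≤ κ₀ := by rw [hκ₀]; unfold B9Ineq368PPrime.kappa349; positivity
  have hsq : 0 ≤ Real.sqrt (Fintype.card κ) := Real.sqrt_nonneg _
  have hw1i : ∀ a : g.Site, 0 ≤ (g.len a)⁻¹ := fun a => inv_nonneg.mpr (hlen a).le
  have e : G ∘ₗ Qcs ∘ₗ Cop ∘ₗ Qc ∘ₗ G = G * (Qcs ∘ₗ Cop ∘ₗ Qc) * G := rfl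
  have hZl : HasL2Majorant (g := toB6 g R H) (fun p : S × ι => blk p.1) ((0 : Module.End ℝ (S × ι → ℝ)) * G)
      (fun a a' => B₀ * g.len a * Real.exp (-(δ * g.dist a a'))) := by
    rw [zero_mul]
    exact hasL2Majorant_mono (g := toB6 g R H) _ (hasL2Majorant_zero (g := toB6 g R H) _) fun a a' =>
      mul_nonneg (mul_nonneg hB₀ (hlen a).le) (Real.exp_nonneg _)
  have hZr : HasL2Majorant (g := toB6 g R H) (fun p : S × ι => blk p.1) (G * (0 : Module.End ℝ (S × ι → ℝ)))
      (fun a a' => B₀ * g.len a * Real.exp (-(δ * g.dist a a'))) := by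
    rw [mul_zero]
    exact hasL2Majorant_mono (g := toB6 g R H) _ (hasL2Majorant_zero (g := toB6 g R H) _) fun a a' =>
      mul_nonneg (mul_nonneg hB₀ (hlen a).le) (Real.exp_nonneg _)
  have call := fun (D Ds : Module.End ℝ (S × ι → ℝ))
      (hD : HasL2Majorant (g := toB6 g R H) (fun p : S × ι => blk p.1) (D * G) (fun a a' => B₀ * g.len a * Real.exp (-(δ * g.dist a a'))))
      (hDs : HasL2Majorant (g := toB6 g R H) (fun p : S × ι => blk p.1) (G * Ds) (fun a a' => B₀ * g.len a * Real.exp (-(δ * g.dist a a')))) =>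
    ineq349_l2_of_readingsP (R := R) (H := H) (fun p : S × ι => blk p.1) blkY d δ₀ δ α β ρ Λ B₀ δC αC ΛC κc κs BC wc ws hB₀ hΛ hρ hα hβ hδ₀ hr
      hκc hκs hBC hΛC hws hprod hδC hdnn htri hlen h261 hT1 hT2 hT4 hTC hG hD hDs hQc hQcs h348
  obtain ⟨hP, -, -, -⟩ := call 0 0 hZl hZr
  have hDP : ∀ μ : κ, HasL2Majorant (g := toB6 g R H) (fun p : S × ι => blk p.1)
      (conj b (diffLetter T U c (Sum.inl μ)) * (G * (Qcs ∘ₗ Cop ∘ₗ Qc) * G))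
      (fun a a' => κ₀ * (g.len a)⁻¹ * Real.exp (-(ρ * g.dist a a'))) :=
    fun μ => (call _ 0 (hDG μ) hZr).2.1
  have hPDs : ∀ ν : κ, HasL2Majorant (g := toB6 g R H) (fun p : S × ι => blk p.1)
      (G * (Qcs ∘ₗ Cop ∘ₗ Qc) * G * conj b (diffLetter T U c (Sum.inr ν)))
      (fun a a' => κ₀ * (g.len a)⁻¹ * Real.exp (-(ρ * g.dist a a'))) :=
    fun ν => (call 0 _ hZl (hGDs ν)).2.2.1
  have hK0 : ∀ a a' : g.Site, 0 ≤ κ₀ * (g.len a)⁻¹ * Real.exp (-(ρ * g.dist a a')) := fun a a' => by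
    have := hw1i a; positivity
  have hHomD := hasL2MajorantHom_gradLin_comp (R := R) (H := H) b T U blk c hDP
  have hHomDs := hasL2MajorantHom_comp_divLin (R := R) (H := H) b T U blk c hK0 hPDs
  rw [e]
  refine ⟨?_, ?_, ?_⟩
  · refine hasL2Majorant_mono (g := toB6 g R H) _ hP fun a a' => ?_
    have h0 : 0 ≤ κ₀ * Real.exp (-(ρ * g.dist a a')) := by positivity
    have h1 : (1 : ℝ) ≤ 1 + Real.sqrt (Fintype.card κ) := le_add_of_nonneg_right hsq
    calc κ₀ * Real.exp (-(ρ * g.dist a a')) = 1 * (κ₀ * Real.exp (-(ρ * g.dist a a'))) := (one_mul _).symm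
      _ ≤ (1 + Real.sqrt (Fintype.card κ)) * (κ₀ * Real.exp (-(ρ * g.dist a a'))) := mul_le_mul_of_nonneg_right h1 h0
      _ = _ := by ring
  · refine hasL2MajorantHom_mono (g := toB6 g R H) _ _ hHomD fun a a' => ?_
    have h0 := hK0 a a'
    have h1 : Real.sqrt (Fintype.card κ) ≤ 1 + Real.sqrt (Fintype.card κ) := le_add_of_nonneg_left zero_le_one
    calc Real.sqrt (Fintype.card κ) * (κ₀ * (g.len a)⁻¹ * Real.exp (-(ρ * g.dist a a')))
        ≤ (1 + Real.sqrt (Fintype.card κ)) * (κ₀ * (g.len a)⁻¹ * Real.exp (-(ρ * g.dist a a'))) := mul_le_mul_of_nonneg_right h1 h0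
      _ = _ := by ring
  · refine hasL2MajorantHom_mono (g := toB6 g R H) _ _ hHomDs fun a a' => ?_
    have h0 := hK0 a a'
    have h1 : Real.sqrt (Fintype.card κ) ≤ 1 + Real.sqrt (Fintype.card κ) := le_add_of_nonneg_left zero_le_one
    calc Real.sqrt (Fintype.card κ) * (κ₀ * (g.len a)⁻¹ * Real.exp (-(ρ * g.dist a a')))
        ≤ (1 + Real.sqrt (Fintype.card κ)) * (κ₀ * (g.len a)⁻¹ * Real.exp (-(ρ * g.dist a a'))) := mul_le_mul_of_nonneg_right h1 h0
      _ = _ := by ring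

end Hom

end Literature.MathematicalPhysics.QuantumFieldTheory.Balaban1983to89.B9Ineq349L2ReadingsP

end
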